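/-
Origin: expansion seat `planner-pub-hodgecm-pv10-g5-0`, handover #2 2026-08-18T14:17:10Z ; rewrite: ^import Pv10g5\.QuotientManifold -> import HodgeCM.PerL34.QuotientManifold (`HOME/pub-hodgecm-pv10-g5/lean/Pv10g5/BallQuotientManifold.lean`, md5 c4e0333b, 288 lines);
landed by the gen-8 packager in gate run 30 as `HodgeCM/PerL34/BallQuotientManifold.lean` (import ^import Pv10g5\.QuotientManifold[ \t]*$→import HodgeCM.PerL34.QuotientManifold ×1; stripped 5 #print/#check/#eval lines).
-/
/-
Origin: pub-hodgecm speedrun cell, seat pv10-g5 (DAG-NODE PROVER #10, gen 5), 2026-08-18.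
Target path: `HodgeCM/PerL34/BallQuotientManifold.lean`.
WIP import `Pv10g5.QuotientManifold` ↦ `HodgeCM.PerL34.QuotientManifold` at landing (ONE rewrite); the three
`HodgeCM.PerL34.*` imports are tree modules.  KERNEL, nothing cited, nothing posited.
-/
import Summits.HodgeConjecture.HodgeCM.PerL34.BallQuotient
import Summits.HodgeConjecture.HodgeCM.PerL34.ShimuraSetBall
import Summits.HodgeConjecture.HodgeCM.PerL34.SmallLevelTorsionFree_2
import Summits.HodgeConjecture.HodgeCM.PerL34.QuotientManifold

/-!
# The complex structure on `Γ \ 𝔹²` (PerL v5 §1.2, ll. 72–73)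

PerL v5 §1.2 ll. 72–73 (verbatim): "A *congruence subgroup* is `Γ = G_U(L_0) ∩ K_f` for some compact
open `K_f`; for torsion-free `Γ`, `P^L_Γ := Γ\𝔹²` is a smooth projective surface".

This file makes the COMPLEX-ANALYTIC half of that sentence KERNEL:

* `𝔹² = {z ∈ ℂ² : |z₀|² + |z₁|² < 1}` (`BallModel.Ball`) is a complex-analytic manifold modelled on `ℂ²`
  (`instChartedSpaceBall`, `instIsManifoldBall`: one chart, the open embedding `inclusion : 𝔹² ↪ ℂ²`);
* `U(2,1)` (`BallModel.U21`) acts on `𝔹²` by HOLOMORPHIC maps: in the chart the action of `γ` is the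
  linear-fractional map `moebius γ`, `ContDiffOn ℂ ω` on the ball (`contDiffOn_moebius`, `val_smul`), so
  `(γ • ·)` read in the chart lies in the analytic groupoid `contDiffGroupoid ω 𝓘(ℂ, ℂ²)`
  (`smul_mem_contDiffGroupoid`);
* a discrete subgroup `Γ ≤ U(2,1)` acts properly discontinuously (`U(2,1)` acts properly, tree
  `BallStabilizer.properSMul_ball`), and freely iff all isotropy groups `Stab_{U(2,1)}(z) ⊓ Γ` are trivial
  (`isCancelSMul_of_stabilizer_inf_eq_bot`);
* hence, by `QuotientManifold.isManifold_orbitRelQuotient` (Mathlib's quotient-manifold TODO, proved in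
  `HodgeCM/PerL34/QuotientManifold.lean`): **for every discrete `Γ ≤ U(2,1)` acting freely, `Γ \ 𝔹²` is a
  complex-analytic manifold modelled on `ℂ²` — `IsManifold 𝓘(ℂ, Fin 2 → ℂ) ω (orbitRel.Quotient Γ 𝔹²)` —
  and Hausdorff** (`isManifold_ballQuotient`; Hausdorff is the tree's
  `BallStabilizer.t2Space_ballQuotient_of_discrete`);
* **PerL's pieces**: for a hermitian 3-space `V` over the CM field `L`, a Sylvester frame `T` at `ι₁` and a
  compact level `K_f ≤ K_H(3)`, every lattice `Γ_H(bK_fb⁻¹)' = archToU21 (G_U(L₀) ∩ bK_fb⁻¹) ≤ U(2,1)` is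
  discrete and acts freely (tree: `torsionFree_congruenceLattice_conj`, `stabilizer_ball_eq_bot`), so
  **`Γ_H(bK_fb⁻¹)' \ 𝔹²` is a complex-analytic surface** (`HermSpace3.isManifold_ballPiece`); these are
  exactly the summands of `S(K_f) ≃ Σ_j Γ_j' \ 𝔹²` (tree `HermSpace3.shimuraSetEquivBall`).

NOT claimed (stays PRINT): projectivity / algebraicity of `Γ \ 𝔹²` (Kodaira embedding, or Baily–Borel for
the compact quotient), "smooth projective surface" as an algebraic variety, anything about `P_K` as a scheme.
Compactness (`[L:ℚ] ≠ 2`, tree `compactSpace_piece`) and Hausdorffness are already KERNEL in the tree.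
-/

noncomputable section

open scoped Matrix Pointwise Manifold ContDiff Topology
open MulAction Set

namespace HodgeCM.PerL34.BallComplex

open HodgeCM.PerL34.BallModel

/-! ## §1  `𝔹²` as an open submanifold of `ℂ²` -/

/-- The open unit ball of `ℂ²` as a subset. -/
def ballSet : Set (Fin 2 → ℂ) := {x | nsq x < 1}

/-- (Ported verbatim from the HodgeCMPerL package; no docstring in the source.) -/
theorem ballSet_isOpen : IsOpen ballSet := isOpen_lt BallFrame.continuous_nsq continuous_const

/-- The inclusion `𝔹² ↪ ℂ²`. -/
def inclusion (z : Ball) : Fin 2 → ℂ := z.1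

/-- (Ported verbatim from the HodgeCMPerL package; no docstring in the source.) -/
@[simp] theorem inclusion_apply (z : Ball) : inclusion z = z.1 := rfl

/-- (Ported verbatim from the HodgeCMPerL package; no docstring in the source.) -/
theorem range_inclusion : range inclusion = ballSet :=
  Set.ext fun x => ⟨by rintro ⟨z, rfl⟩; exact z.2, fun hx => ⟨⟨x, hx⟩, rfl⟩⟩

/-- `𝔹² ↪ ℂ²` is an open embedding. -/
theorem isOpenEmbedding_inclusion : Topology.IsOpenEmbedding inclusion :=
  ⟨Topology.IsEmbedding.subtypeVal, by rw [range_inclusion]; exact ballSet_isOpen⟩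

/-- (Ported verbatim from the HodgeCMPerL package; no docstring in the source.) -/
instance instNonemptyBall : Nonempty Ball := ⟨x₀⟩

/-- (Ported verbatim from the HodgeCMPerL package; no docstring in the source.) -/
instance instT2SpaceBall : T2Space Ball := isOpenEmbedding_inclusion.isEmbedding.t2Space

/-- (Ported verbatim from the HodgeCMPerL package; no docstring in the source.) -/
instance instLocallyCompactSpaceBall : LocallyCompactSpace Ball :=
  isOpenEmbedding_inclusion.locallyCompactSpace

/-- The complex chart of `𝔹²`: the single chart `𝔹² ↪ ℂ²`. -/
instance instChartedSpaceBall : ChartedSpace (Fin 2 → ℂ) Ball :=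
  isOpenEmbedding_inclusion.singletonChartedSpace

/-- The chart of `𝔹²` (as an open partial homeomorphism `𝔹² → ℂ²`). -/
def ballChart : OpenPartialHomeomorph Ball (Fin 2 → ℂ) :=
  isOpenEmbedding_inclusion.toOpenPartialHomeomorph inclusion

/-- (Ported verbatim from the HodgeCMPerL package; no docstring in the source.) -/
theorem chartAt_eq (z : Ball) : chartAt (Fin 2 → ℂ) z = ballChart := rfl

/-- (Ported verbatim from the HodgeCMPerL package; no docstring in the source.) -/
theorem eq_ballChart_of_mem_atlas {e : OpenPartialHomeomorph Ball (Fin 2 → ℂ)}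
    (he : e ∈ atlas (Fin 2 → ℂ) Ball) : e = ballChart := he

/-- (Ported verbatim from the HodgeCMPerL package; no docstring in the source.) -/
@[simp] theorem ballChart_apply (z : Ball) : ballChart z = z.1 := rfl

/-- (Ported verbatim from the HodgeCMPerL package; no docstring in the source.) -/
theorem ballChart_source : ballChart.source = univ :=
  Topology.IsOpenEmbedding.toOpenPartialHomeomorph_source _ _

/-- (Ported verbatim from the HodgeCMPerL package; no docstring in the source.) -/
theorem ballChart_target : ballChart.target = ballSet := by
  rw [ballChart, Topology.IsOpenEmbedding.toOpenPartialHomeomorph_target, range_inclusion]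

/-- (Ported verbatim from the HodgeCMPerL package; no docstring in the source.) -/
theorem ballChart_symm_apply {x : Fin 2 → ℂ} (hx : x ∈ ballSet) : ballChart.symm x = ⟨x, hx⟩ :=
  isOpenEmbedding_inclusion.toOpenPartialHomeomorph_left_inv (x := (⟨x, hx⟩ : Ball))

/-- **`𝔹²` is a complex-analytic manifold modelled on `ℂ²`.** -/
instance instIsManifoldBall : IsManifold 𝓘(ℂ, Fin 2 → ℂ) ω Ball :=
  isOpenEmbedding_inclusion.isManifold_singleton

/-! ## §2  `U(2,1)` acts on `𝔹²` by holomorphic maps -/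

/-- Row `k` of `γ` applied to `(x₀, x₁, 1)`: `γ_{k0} x₀ + γ_{k1} x₁ + γ_{k2}`. -/
def row (γ : U21) (k : Fin 3) (x : Fin 2 → ℂ) : ℂ := mat γ k 0 * x 0 + mat γ k 1 * x 1 + mat γ k 2

/-- (Ported verbatim from the HodgeCMPerL package; no docstring in the source.) -/
theorem W3_eq_row (γ : U21) (z : Ball) (k : Fin 3) : W3 γ z k = row γ k z.1 := by
  simp [W3, row, Matrix.mulVec, dotProduct, Fin.sum_univ_three, lift]

/-- (Ported verbatim from the HodgeCMPerL package; no docstring in the source.) -/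
theorem row_two_ne_zero (γ : U21) {x : Fin 2 → ℂ} (hx : x ∈ ballSet) : row γ 2 x ≠ 0 := by
  have h := W3_2_ne_zero γ ⟨x, hx⟩
  rwa [W3_eq_row] at h

/-- (Ported verbatim from the HodgeCMPerL package; no docstring in the source.) -/
theorem contDiff_row (γ : U21) (k : Fin 3) : ContDiff ℂ ω (row γ k) :=
  ((contDiff_const.mul (contDiff_apply ℂ ℂ 0)).add (contDiff_const.mul (contDiff_apply ℂ ℂ 1))).add
    contDiff_const

/-- The linear-fractional (Möbius) map of `γ ∈ U(2,1)` on `ℂ²`: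
`x ↦ ((γ(x,1))₀, (γ(x,1))₁) / (γ(x,1))₂`. -/
def moebius (γ : U21) (x : Fin 2 → ℂ) : Fin 2 → ℂ := fun i => row γ (Fin.castSucc i) x / row γ 2 x

/-- The action of `U(2,1)` on `𝔹²`, read in the chart, IS the Möbius map. -/
theorem val_smul (γ : U21) (z : Ball) : (γ • z).1 = moebius γ z.1 := by
  funext i
  rw [smul_val, W3_eq_row, W3_eq_row]
  rfl

/-- **The Möbius map of `γ ∈ U(2,1)` is holomorphic (`ContDiffOn ℂ ω`) on the ball.** -/
theorem contDiffOn_moebius (γ : U21) : ContDiffOn ℂ ω (moebius γ) ballSet :=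
  contDiffOn_pi.mpr fun _ =>
    (contDiff_row γ _).contDiffOn.div (contDiff_row γ 2).contDiffOn fun _ hx => row_two_ne_zero γ hx

/-- (Ported verbatim from the HodgeCMPerL package; no docstring in the source.) -/
theorem mapsTo_moebius (γ : U21) : MapsTo (moebius γ) ballSet ballSet := fun x hx => by
  have h := (γ • ballChart.symm x).2
  rw [val_smul, ballChart_symm_apply hx] at h
  exact h

/-- The action of `γ` conjugated by the chart is holomorphic on the ball. -/
theorem contDiffOn_val_smul_symm (γ : U21) :
    ContDiffOn ℂ ω (fun x => (γ • ballChart.symm x).1) ballSet :=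
  (contDiffOn_moebius γ).congr fun x hx => by simp only [ballChart_symm_apply hx, val_smul]

/-- **`U(2,1)` acts by maps of the analytic groupoid**: for every subgroup `Γ ≤ U(2,1)` and `γ ∈ Γ`, the
homeomorphism `(γ • ·)` of `𝔹²` read in the chart `𝔹² ↪ ℂ²` belongs to `contDiffGroupoid ω 𝓘(ℂ, ℂ²)`. -/
theorem smul_mem_contDiffGroupoid (Γ : Subgroup U21) (γ : Γ) :
    ballChart.symm.trans ((Homeomorph.smul γ : Ball ≃ₜ Ball).toOpenPartialHomeomorph.trans ballChart) ∈
      contDiffGroupoid ω 𝓘(ℂ, Fin 2 → ℂ) := by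
  rw [contDiffGroupoid, mem_groupoid_of_pregroupoid]
  have hsrc : (ballChart.symm.trans
      ((Homeomorph.smul γ : Ball ≃ₜ Ball).toOpenPartialHomeomorph.trans ballChart)).source = ballSet := by
    simp [ballChart_target, ballChart_source]
  have htgt : (ballChart.symm.trans
      ((Homeomorph.smul γ : Ball ≃ₜ Ball).toOpenPartialHomeomorph.trans ballChart)).target = ballSet := by
    simp [ballChart_target, ballChart_source]
  simp only [contDiffPregroupoid, modelWithCornersSelf_coe, modelWithCornersSelf_coe_symm,
    Function.comp_id, Function.id_comp, range_id, preimage_id, inter_univ, hsrc, htgt]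
  refine ⟨(contDiffOn_val_smul_symm (γ : U21)).congr fun x hx => ?_,
    (contDiffOn_val_smul_symm ((γ : U21)⁻¹)).congr fun x hx => ?_⟩
  · simp [Subgroup.smul_def]
  · simp [Subgroup.smul_def, OpenPartialHomeomorph.trans_symm_eq_symm_trans_symm]

/-! ## §3  Discrete subgroups of `U(2,1)`: properly discontinuous, free -/

/-- A discrete subgroup of `U(2,1)` acts properly discontinuously on `𝔹²` (`U(2,1)` acts properly,
`BallStabilizer.properSMul_ball`; closed subgroups inherit properness; proper ⇔ properly discontinuous for
discrete groups on locally compact Hausdorff spaces). -/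
instance properlyDiscontinuousSMul_ball (Γ : Subgroup U21) [DiscreteTopology Γ] :
    ProperlyDiscontinuousSMul Γ Ball := by
  haveI := BallStabilizer.properSMul_ball
  haveI : ProperSMul Γ Ball :=
    properSMul_of_isClosedEmbedding Γ.subtype Subgroup.isClosed_of_discrete.isClosedEmbedding_subtypeVal
      fun _ _ => rfl
  exact properlyDiscontinuousSMul_iff_properSMul.mpr this

/-- Freeness: if every isotropy group `Stab_{U(2,1)}(z) ⊓ Γ` is trivial then `Γ` acts freely
(`IsCancelSMul`) on `𝔹²`. -/
theorem isCancelSMul_of_stabilizer_inf_eq_bot (Γ : Subgroup U21)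
    (hfree : ∀ z : Ball, MulAction.stabilizer U21 z ⊓ Γ = ⊥) : IsCancelSMul Γ Ball := by
  rw [isCancelSMul_iff_stabilizer_eq_bot]
  intro z
  rw [Subgroup.eq_bot_iff_forall]
  intro γ hγ
  have h : (γ : U21) ∈ MulAction.stabilizer U21 z ⊓ Γ :=
    Subgroup.mem_inf.mpr ⟨MulAction.mem_stabilizer_iff.mpr (MulAction.mem_stabilizer_iff.mp hγ), γ.2⟩
  rw [hfree z, Subgroup.mem_bot] at h
  exact Subtype.ext h

/-- Conversely a free action has trivial isotropy. -/
theorem stabilizer_inf_eq_bot_of_isCancelSMul (Γ : Subgroup U21) [IsCancelSMul Γ Ball] (z : Ball) :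
    MulAction.stabilizer U21 z ⊓ Γ = ⊥ := by
  rw [Subgroup.eq_bot_iff_forall]
  rintro g ⟨hg, hgΓ⟩
  have h := IsCancelSMul.stabilizer_eq_bot (G := Γ) z
  rw [Subgroup.eq_bot_iff_forall] at h
  have := h ⟨g, hgΓ⟩ (MulAction.mem_stabilizer_iff.mpr (MulAction.mem_stabilizer_iff.mp hg))
  simpa using congrArg Subtype.val this

/-! ## §4  `Γ \ 𝔹²` is a complex-analytic surface -/

/-- **For every discrete subgroup `Γ ≤ U(2,1)` acting freely on `𝔹²`, the quotient `Γ \ 𝔹²` is a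
complex-analytic manifold modelled on `ℂ²`** (charts: Mathlib's `MulAction.instChartedSpaceQuotient`, local
sections of the covering `𝔹² → Γ\𝔹²` followed by `𝔹² ↪ ℂ²`; transition maps are restrictions of Möbius maps
`moebius γ`, `γ ∈ Γ`). -/
theorem isManifold_ballQuotient (Γ : Subgroup U21) [DiscreteTopology Γ] [IsCancelSMul Γ Ball] :
    IsManifold 𝓘(ℂ, Fin 2 → ℂ) ω (orbitRel.Quotient Γ Ball) :=
  QuotientManifold.isManifold_orbitRelQuotient 𝓘(ℂ, Fin 2 → ℂ) ω fun γ e he e' he' => by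
    rw [eq_ballChart_of_mem_atlas he, eq_ballChart_of_mem_atlas he']
    exact smul_mem_contDiffGroupoid Γ γ

/-- The quotient map `𝔹² → Γ \ 𝔹²` is a covering map and a local homeomorphism. -/
theorem isCoveringMap_ballQuotientMk (Γ : Subgroup U21) [DiscreteTopology Γ] [IsCancelSMul Γ Ball] :
    IsCoveringMap (Quotient.mk (orbitRel Γ Ball) : Ball → orbitRel.Quotient Γ Ball) :=
  (QuotientManifold.isQuotientCoveringMap_mk Γ Ball).isCoveringMap

end HodgeCM.PerL34.BallComplex

/-! ## §5  PerL v5 ll. 72–73: the pieces `Γ_H(bK_fb⁻¹)' \ 𝔹²` are complex surfaces -/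

namespace HodgeCM.PerL34.ArchCompactK

section PerLBall

open HodgeCM.PerL34.Godement HodgeCM.PerL34.AdelicUnitaryFactorisation HodgeCM.PerL34.BallComplex
open Literature.AlgebraicGeometry.ShimuraVarieties (signatureMatrix)
open HodgeCM.PerL34.BallModel (U21 Ball x₀)
open NumberField

variable (L : CMField) {ι₁ : L →+* ℂ} (V : HermSpace3 L ι₁) {T : GL (Fin 3) ℂ}
  (hT : (T : Matrix (Fin 3) (Fin 3) ℂ)ᴴ * V.Hm.map (InfinitePlace.mk ι₁).embedding *
    (T : Matrix (Fin 3) (Fin 3) ℂ) = signatureMatrix 2)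

include hT

/-- The image lattice `Γ' = archToU21 (Γ) ≤ U(2,1)` of a discrete `Γ ≤ G_U(ℝ)` acting freely on
`G_U(ℝ)/K_∞` is discrete and acts freely on `𝔹²`; hence `Γ' \ 𝔹²` is a complex-analytic surface. -/
theorem isManifold_ballQuotient_map (Γ : Subgroup (Uinf L V.Hm)) [DiscreteTopology Γ]
    (hfree : ∀ q : Uinf L V.Hm ⧸ V.archK T, MulAction.stabilizer (Uinf L V.Hm) q ⊓ Γ = ⊥) :
    haveI : DiscreteTopology (Γ.map (V.archToU21 hT)) := HodgeCM.HermSpace3.discreteTopology_map_archToU21 V hT Γ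
    haveI : IsCancelSMul (Γ.map (V.archToU21 hT)) Ball :=
      isCancelSMul_of_stabilizer_inf_eq_bot _ (stabilizer_ball_eq_bot L V hT Γ hfree)
    IsManifold 𝓘(ℂ, Fin 2 → ℂ) ω (orbitRel.Quotient (Γ.map (V.archToU21 hT)) Ball) := by
  haveI : DiscreteTopology (Γ.map (V.archToU21 hT)) :=
    HodgeCM.HermSpace3.discreteTopology_map_archToU21 V hT Γ
  haveI : IsCancelSMul (Γ.map (V.archToU21 hT)) Ball :=
    isCancelSMul_of_stabilizer_inf_eq_bot _ (stabilizer_ball_eq_bot L V hT Γ hfree)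
  exact isManifold_ballQuotient _

/-- **PerL v5 §1.2 ll. 72–73 ON THE BALL (KERNEL, complex-analytic half).**  For a hermitian 3-space `V` over
the CM field `L`, a Sylvester frame `T` at `ι₁`, a COMPACT level `K_f ≤ K_H(3)` and ANY `b ∈ G_U(𝔸_f)`: the
lattice `Γ_H(bK_fb⁻¹)' := archToU21 (G_U(L₀) ∩ bK_fb⁻¹) ≤ U(2,1)` is discrete, acts freely on `𝔹²`, and
**`Γ_H(bK_fb⁻¹)' \ 𝔹²` is a complex-analytic manifold modelled on `ℂ²`** (Hausdorff by the tree's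
`BallStabilizer.t2Space_ballQuotient_of_discrete`; compact for `[L:ℚ] ≠ 2` and `K_f` open by the tree's
`compactSpace_piece`).  These are the summands of `S(K_f) ≃ Σ_j Γ_j' \ 𝔹²` (`HermSpace3.shimuraSetEquivBall`).  Projectivity is NOT claimed. -/
theorem _root_.HodgeCM.HermSpace3.isManifold_ballPiece (Kf : Subgroup (Ufin L V.Hm))
    (hKc : IsCompact (Kf : Set (Ufin L V.Hm))) (hK3 : Kf ≤ levelUfin L V.Hm 3) (b : Ufin L V.Hm) :
    haveI : DiscreteTopology ((congruenceLattice L V.Hm (MulAut.conj b • Kf)).map (V.archToU21 hT)) :=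
      haveI := HodgeCM.HermSpace3.discreteTopology_congruenceLattice L V _ (isCompact_conj_smul Kf hKc b)
      HodgeCM.HermSpace3.discreteTopology_map_archToU21 V hT _
    haveI : IsCancelSMul ((congruenceLattice L V.Hm (MulAut.conj b • Kf)).map (V.archToU21 hT)) Ball :=
      isCancelSMul_of_stabilizer_inf_eq_bot _ (HodgeCM.HermSpace3.shimuraSet_pieces_ball_free L V hT Kf hKc b
        (torsionFree_congruenceLattice_conj L le_rfl hK3 b))
    IsManifold 𝓘(ℂ, Fin 2 → ℂ) ω
      (orbitRel.Quotient ((congruenceLattice L V.Hm (MulAut.conj b • Kf)).map (V.archToU21 hT)) Ball) := by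
  haveI : DiscreteTopology ((congruenceLattice L V.Hm (MulAut.conj b • Kf)).map (V.archToU21 hT)) :=
    haveI := HodgeCM.HermSpace3.discreteTopology_congruenceLattice L V _ (isCompact_conj_smul Kf hKc b)
    HodgeCM.HermSpace3.discreteTopology_map_archToU21 V hT _
  haveI : IsCancelSMul ((congruenceLattice L V.Hm (MulAut.conj b • Kf)).map (V.archToU21 hT)) Ball :=
    isCancelSMul_of_stabilizer_inf_eq_bot _ (HodgeCM.HermSpace3.shimuraSet_pieces_ball_free L V hT Kf hKc b
      (torsionFree_congruenceLattice_conj L le_rfl hK3 b))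
  exact isManifold_ballQuotient _

end PerLBall

end HodgeCM.PerL34.ArchCompactK

end

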